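import Summits.AtomisticToContinuum.HydrodynamicLimit.Theorems.RelayRaceLocalityNearConstantShortTimeHLMeansPinStatics
import Summits.AtomisticToContinuum.HydrodynamicLimit.Theorems.RelayRaceLocalityNearConstantShortTimeHLGeneralFamilyConcentration
import Summits.AtomisticToContinuum.HydrodynamicLimit.Theorems.RelayRaceLocalityNearConstantShortTimeHLSmallTiltDefs
import HarnessLib

/-!
# Crux `NearConstantShortTimeHL` (stmt-AtomisticToContinuum-12502), line `small-tilt-domination` — stub `stub_staticLLN` (S5a)

Support file (`--supports stmt-AtomisticToContinuum-12502`) proving the registered stub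

  `stub_staticLLN : GeneralFamilyStaticLLN`

of the line `small-tilt-domination` (skeleton `Cruxes/NearConstantShortTimeHL/Lines/small_tilt_domination.lean`;
typed statement `GeneralFamilyStaticLLN` in `…NearConstantShortTimeHLSmallTiltDefs.lean`): the STATIC law of large
numbers at flow-time `0`, with activity inversion, of the canonical local Gibbs laws of an arbitrary continuous
positive activity profile `a₀` (and `θ₀ > 0`, `u₀` continuous) along a general admissible family
`(ε_N → 0, n_N ε_N³ → σ³)`, for `σ < σ₀(a₀)`.

The argument is the `t = 0` half of the pin `stub_meansPin` (`…NearConstantShortTimeHLMeansPin.lean`), flow-free: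

1. bounds `Λ⁻¹ ≤ a₀ ≤ Λ`, `Λ ≥ 1`, on the compact torus; threshold `σ₀ = min(1, η_A/Λ², η₁^{S2}/(2Λ²))` with `η_A` the
   inversion threshold of `activity_inversion_continuous` (fed by the analytic low-density equation of state
   `hsEosLowDensity_proof`) and `η₁^{S2}` the packing threshold of `GeneralFamilyConcentration`
   (`stub_concentrationGeneralFamilies`, landed);
2. inversion `a₀ = e^c ρa e^{g_σ(ρa)}` with `ρa` continuous, `(2Λ²)⁻¹ ≤ ρa ≤ 2Λ²`, unit mass;
3. the constant `e^c` drops out of the canonical law (`KineticWindowGronwallNegative.canonicalDensity_const_mul`), so the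
   crux's law `P_N` IS the matched law `Q_N` of `(ρa, u₀, θ₀)` (`particleLaw = liouville.withDensity`, by `rfl`);
4. `GeneralFamilyConcentration` gives `Q_N(deviation > δ) ≤ C e^{-n_N/C}` for the three empirical fields, `n_N → ∞`
   (`tendsto_atTop_of_tendsto_mul_pow_three`) makes it tend to `0` (`tendsto_zero_of_le_exp`), and `Φ₀ = id` almost
   surely (`measure_setOf_flow_zero_mem`, `P_N ≪ liouville`) moves the statement to flow-time `0`.

References: E. Pulvirenti – D. Tsagkarogiannis, Comm. Math. Phys. 316 (2012) Thm 2.1 (cluster expansion in the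
canonical ensemble / activity inversion); H.-T. Yau, Lett. Math. Phys. 22 (1991) §2.
-/

noncomputable section

namespace Summit.AtomisticToContinuum.HydrodynamicLimit.Theorems.NearConstantShortTimeHL

open MeasureTheory Set Filter Topology
open scoped ENNReal
open Literature.MathematicalPhysics.KineticTheory Literature.Analysis.FluidPDE Literature.Analysis.FunctionSpaces

/-- **S5a, explicit form — STATIC LAW OF LARGE NUMBERS AT TIME ZERO WITH ACTIVITY INVERSION, GENERAL FAMILIES.**
For all continuous profiles `a₀, θ₀ > 0`, `u₀` there is `σ₀ > 0` such that for `0 < σ < σ₀` the activity is inverted,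
`a₀ = e^c · ρa · e^{g_σ(ρa)}` with `ρa` continuous, positive, of unit mass (`activity_inversion_continuous`), and along
every admissible family and all flows the three empirical fields at flow-time `0` satisfy, under the canonical local
Gibbs laws of `(a₀, u₀, θ₀)`, the law of large numbers towards `(∫χρa, ∫χρa u₀, ∫χE(ρa, u₀, θ₀))` for every continuous
`χ`: the constant drops out of the canonical law (`KineticWindowGronwallNegative.canonicalDensity_const_mul`), the law
is the matched law of `(ρa, u₀, θ₀)`, `stub_concentrationGeneralFamilies` gives exponential concentration, `n_N → ∞`,
and `Φ₀ = id` almost surely (`measure_setOf_flow_zero_mem`). [cite: PulvirentiTsagkarogiannis2012, Thm 2.1] -/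
theorem staticLLN_explicit :
    ∀ (a₀ θ₀ : T3 → ℝ) (u₀ : T3 → V3), Continuous a₀ → Continuous θ₀ → Continuous u₀ →
    (∀ x, 0 < a₀ x) → (∀ x, 0 < θ₀ x) → ∃ σ₀ : ℝ, 0 < σ₀ ∧ ∀ σ : ℝ, 0 < σ → σ < σ₀ →
    ∃ ρa : T3 → ℝ, Continuous ρa ∧ (∀ x, 0 < ρa x) ∧ (∫ x, ρa x) = 1 ∧
    (∃ c : ℝ, ∀ x, a₀ x = Real.exp c * ρa x *
      Real.exp (hsExcessFreeEnergy (ρa x * σ ^ 3) + ρa x * σ ^ 3 * deriv hsExcessFreeEnergy (ρa x * σ ^ 3))) ∧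
    ∀ (ε : ℕ → ℝ) (n : ℕ → ℕ), (∀ N, 0 < ε N) → Tendsto ε atTop (nhds 0) →
    Tendsto (fun N => (n N : ℝ) * ε N ^ 3) atTop (nhds (σ ^ 3)) →
    ∀ Φ : (N : ℕ) → HardSphereFlow (Torus.geometry (Fin 3)) (ε N) (n N),
    let P : (N : ℕ) → Measure (Config (n N) (Fin 3) T3) := fun N =>
      particleLaw (Φ N) (canonicalDensity (Torus.geometry (Fin 3)) (ε N) (n N) (localGibbsProfile a₀ u₀ θ₀));
    (∀ N, IsProbabilityMeasure (P N)) →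
    ∀ χ : T3 → ℝ, Continuous χ → ∀ δ : ℝ, 0 < δ →
      Tendsto (fun N => P N {z | δ < |empiricalDensityField ((Φ N).flow 0 z) χ - ∫ x, χ x * ρa x|}) atTop (nhds 0) ∧
      Tendsto (fun N => P N {z | δ < ‖empiricalMomentumField ((Φ N).flow 0 z) χ - ∫ x, (χ x * ρa x) • u₀ x‖})
        atTop (nhds 0) ∧
      Tendsto (fun N => P N {z | δ < |empiricalEnergyField ((Φ N).flow 0 z) χ -
        ∫ x, χ x * totalEnergyDensity (ρa x) (u₀ x) (θ₀ x)|}) atTop (nhds 0) := by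
  intro a₀ θ₀ u₀ ha hθ hu ha0 hθ0
  obtain ⟨η₂, hη₂, H2⟩ := stub_concentrationGeneralFamilies
  obtain ⟨ηE, hηE, F, hFa, hEqF, hF0, -, -⟩ := hsEosLowDensity_proof
  obtain ⟨ηA, hηA, hinvA⟩ := activity_inversion_continuous hηE hFa hEqF hF0
  -- bounds on the activity profile
  obtain ⟨Aup, -, hAup⟩ := exists_forall_abs_le_of_continuous ha
  obtain ⟨x₀, -, hx₀⟩ := isCompact_univ.exists_isMinOn univ_nonempty ha.continuousOn
  have hamin : ∀ x, a₀ x₀ ≤ a₀ x := fun x => hx₀ (mem_univ x)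
  set Λ : ℝ := max (max Aup (a₀ x₀)⁻¹) 1 with hΛdef
  have hΛ1 : 1 ≤ Λ := le_max_right _ _
  have hΛ0 : 0 < Λ := one_pos.trans_le hΛ1
  have haΛ : ∀ x, Λ⁻¹ ≤ a₀ x ∧ a₀ x ≤ Λ := by
    intro x
    constructor
    · have h1 : (a₀ x₀)⁻¹ ≤ Λ := (le_max_right _ _).trans (le_max_left _ _)
      calc Λ⁻¹ ≤ ((a₀ x₀)⁻¹)⁻¹ := inv_anti₀ (inv_pos.2 (ha0 x₀)) h1
        _ = a₀ x₀ := inv_inv _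
        _ ≤ a₀ x := hamin x
    · exact ((le_abs_self _).trans (hAup x)).trans ((le_max_left _ _).trans (le_max_left _ _))
  -- the threshold in `σ`
  set σA : ℝ := min 1 (min (ηA / Λ ^ 2) (η₂ / (2 * Λ ^ 2))) with hσAdef
  have hσA : 0 < σA := lt_min one_pos (lt_min (by positivity) (by positivity))
  refine ⟨σA, hσA, fun σ hσ hσA' => ?_⟩
  have hσ1 : σ ≤ 1 := (hσA'.trans_le (min_le_left _ _)).le
  have hσ3 : 0 < σ ^ 3 := pow_pos hσ 3
  have hσ3le : σ ^ 3 ≤ σ := by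
    calc σ ^ 3 = σ * (σ * σ) := by ring
      _ ≤ σ * 1 := mul_le_mul_of_nonneg_left (mul_le_one₀ hσ1 hσ.le hσ1) hσ.le
      _ = σ := mul_one σ
  have hΛ2 : 0 < Λ ^ 2 := pow_pos hΛ0 2
  have hpack : Λ ^ 2 * σ ^ 3 ≤ ηA := by
    have h1 : σ ≤ ηA / Λ ^ 2 := (hσA'.trans_le ((min_le_right _ _).trans (min_le_left _ _))).le
    rw [le_div_iff₀ hΛ2] at h1
    calc Λ ^ 2 * σ ^ 3 ≤ Λ ^ 2 * σ := mul_le_mul_of_nonneg_left hσ3le hΛ2.le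
      _ = σ * Λ ^ 2 := mul_comm _ _
      _ ≤ ηA := h1
  have hband2 : 2 * Λ ^ 2 * σ ^ 3 ≤ η₂ := by
    have h2 : (0 : ℝ) < 2 * Λ ^ 2 := by positivity
    have h1 : σ ≤ η₂ / (2 * Λ ^ 2) := (hσA'.trans_le ((min_le_right _ _).trans (min_le_right _ _))).le
    rw [le_div_iff₀ h2] at h1
    calc 2 * Λ ^ 2 * σ ^ 3 ≤ 2 * Λ ^ 2 * σ := mul_le_mul_of_nonneg_left hσ3le h2.le
      _ = σ * (2 * Λ ^ 2) := mul_comm _ _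
      _ ≤ η₂ := h1
  -- the local chemical potential correction `g_σ`
  set g : ℝ → ℝ := fun r => hsExcessFreeEnergy (r * σ ^ 3) + r * σ ^ 3 * deriv hsExcessFreeEnergy (r * σ ^ 3)
    with hgdef
  ------------------------------------------------------------------
  -- Step 1: inversion of the activity
  ------------------------------------------------------------------
  obtain ⟨ρst, hρstc, hρstb, hρst1, c, hc⟩ := hinvA σ hσ Λ hΛ1 hpack a₀ ha haΛ
  have hρst0 : ∀ x, 0 < ρst x := fun x => (by positivity : (0 : ℝ) < (2 * Λ ^ 2)⁻¹).trans_le (hρstb x).1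
  refine ⟨ρst, hρstc, hρst0, hρst1, ⟨c, hc⟩, ?_⟩
  intro ε n hε hε0 hn Φ
  dsimp only
  intro _hP χ hχ δ hδ
  have hn_top : Tendsto n atTop atTop := tendsto_atTop_of_tendsto_mul_pow_three hσ hε hε0 hn
  -- the constant drops out: the crux's laws ARE the matched laws of `(ρst, u₀, θ₀)`
  have ha₀eq : a₀ = fun x => Real.exp c * (ρst x * Real.exp (g (ρst x))) := by
    funext x; rw [hc x]; ring
  have hcd : ∀ N, canonicalDensity (Torus.geometry (Fin 3)) (ε N) (n N) (localGibbsProfile a₀ u₀ θ₀) =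
      canonicalDensity (Torus.geometry (Fin 3)) (ε N) (n N)
        (localGibbsProfile (fun x => ρst x * Real.exp (g (ρst x))) u₀ θ₀) := by
    intro N
    funext z
    rw [ha₀eq, MacroClosureLine.StubLedger.localGibbsProfile_const_mul]
    exact KineticWindowGronwallNegative.canonicalDensity_const_mul (Real.exp_pos c).ne' _ _ z
  have hPeq : ∀ N, particleLaw (Φ N) (canonicalDensity (Torus.geometry (Fin 3)) (ε N) (n N)
      (localGibbsProfile a₀ u₀ θ₀)) =
      particleLaw (Φ N) (canonicalDensity (Torus.geometry (Fin 3)) (ε N) (n N)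
        (localGibbsProfile (fun x => ρst x * Real.exp (g (ρst x))) u₀ θ₀)) := fun N => by rw [hcd N]
  have hac : ∀ N, particleLaw (Φ N) (canonicalDensity (Torus.geometry (Fin 3)) (ε N) (n N)
      (localGibbsProfile a₀ u₀ θ₀)) ≪ liouville (Torus.geometry (Fin 3)) (n N) (ε N) :=
    fun N => withDensity_absolutelyContinuous _ _
  ------------------------------------------------------------------
  -- Step 2: exponential concentration under the matched laws, moved to flow-time `0`
  ------------------------------------------------------------------
  have hS2₀ := H2 σ hσ (2 * Λ ^ 2)⁻¹ (by positivity) ρst hρstc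
    (fun x => ⟨(hρstb x).1, (mul_le_mul_of_nonneg_right (hρstb x).2 hσ3.le).trans hband2⟩) hρst1 u₀ θ₀ hu hθ
    hθ0 ε n hε hε0 hn
  obtain ⟨C, hC, hCN⟩ := hS2₀ χ hχ δ hδ
  refine ⟨tendsto_zero_of_le_exp hn_top hC fun N => ?_, tendsto_zero_of_le_exp hn_top hC fun N => ?_,
    tendsto_zero_of_le_exp hn_top hC fun N => ?_⟩
  · refine (measure_setOf_flow_zero_mem (Φ N) (hac N)
      {z | δ < |empiricalDensityField z χ - ∫ x, χ x * ρst x|}).le.trans ?_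
    rw [hPeq N]
    exact (hCN N).1
  · refine (measure_setOf_flow_zero_mem (Φ N) (hac N)
      {z | δ < ‖empiricalMomentumField z χ - ∫ x, (χ x * ρst x) • u₀ x‖}).le.trans ?_
    rw [hPeq N]
    exact (hCN N).2.1
  · refine (measure_setOf_flow_zero_mem (Φ N) (hac N)
      {z | δ < |empiricalEnergyField z χ - ∫ x, χ x * totalEnergyDensity (ρst x) (u₀ x) (θ₀ x)|}).le.trans ?_
    rw [hPeq N]
    exact (hCN N).2.2

/-- **S5a — registered stub `stub_staticLLN` of line `small-tilt-domination`: the STATIC LAW OF LARGE NUMBERS AT TIME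
ZERO WITH ACTIVITY INVERSION, GENERAL FAMILIES** (`GeneralFamilyStaticLLN`, the statics consumed at `t = 0` by
`stub_meanFieldGronwall`): `staticLLN_explicit` verbatim — activity inversion (`activity_inversion_continuous` at the
analytic low-density equation of state `hsEosLowDensity_proof`), the constant drops out of the canonical law
(`KineticWindowGronwallNegative.canonicalDensity_const_mul`), exponential concentration under the matched laws
(`stub_concentrationGeneralFamilies`), `n_N → ∞`, `Φ₀ = id` a.s. [cite: PulvirentiTsagkarogiannis2012, Thm 2.1] -/
theorem stub_staticLLN : GeneralFamilyStaticLLN := staticLLN_explicit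

end Summit.AtomisticToContinuum.HydrodynamicLimit.Theorems.NearConstantShortTimeHL

end
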